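import Summits.AtomisticToContinuum.HydrodynamicLimit.Theorems.JParityClosureOddContactSymmetryHardCoreMarginals
import Literature.Analysis.FluidPDE.HardSphereTorusMeasure
import Literature.MathematicalPhysics.KineticTheory.HardSphereUniformGasShift
import HarnessLib

/-!
# Static window events of the rung-0 Gibbs law (S2): two close pairs
# (helpers toward the rung-0 collision-count bound; crux `JParityClosure.OddContactSymmetry`,
# stmt-AtomisticToContinuum-13078, line `equilibrium-rung-mean-variance`, transfer debt "tightness")

Lead prover r-1 of the crux.  Under the homogeneous local Gibbs law of `N + 1` hard spheres of
diameter `ε_N = hsDiameter σ N` on `𝕋³` (constant profiles; positions hard-core canonical, velocities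
i.i.d. Maxwellian — `localGibbsMeasure_rung0_eq_map`), the two STATIC events that dominate the short
windows of the first-moment collision-count argument:

* `localGibbsLaw_twoClosePairs_le` (S2) — two distinct unordered pairs both within distance `ε_N + h`:
  probability `O(h²)` (`h → 0`; constants depending on `N, σ`) — each pair sits in a shell of width
  `h` on the support of the law, marginal bound `posGibbsMeasure_marginal_le`, two shell integrations
  (`volume_twoShells_le`, from the phase-space estimate `volume_closePair_inter_closePair_le`);
* (S1, the one-close-pair event, lives in the sibling file `…WindowStaticsOne`.)

References: Gallagher–Saint-Raymond–Texier 2013, Lemma 4.1.2 (volume of data with one / two collisions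
in a short window); Spohn 1991, Part I §2.3.
-/

noncomputable section

open MeasureTheory Set Filter Topology
open scoped ENNReal BigOperators

namespace Summit.AtomisticToContinuum.HydrodynamicLimit.Theorems

open Literature.Analysis.FluidPDE Literature.MathematicalPhysics.KineticTheory
  Literature.MathematicalPhysics.StatisticalMechanics

/-- The thin-shell event `ε ≤ dist(xᵢ, xⱼ) ≤ ε + r` of a configuration of sphere centres on `𝕋³` is
measurable (the pair distance is continuous). [folklore] -/
theorem measurableSet_shell (ε r : ℝ) {n : ℕ} (i j : Fin n) :
    MeasurableSet {x : Fin n → T3 | ε ≤ Torus.euclidDist (x i) (x j) ∧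
      Torus.euclidDist (x i) (x j) ≤ ε + r} := by
  have hm : Measurable fun x : Fin n → T3 => Torus.euclidDist (x i) (x j) :=
    (continuous_euclidDist_apply (d := Fin 3) i j).measurable
  exact (measurableSet_le measurable_const hm).inter (measurableSet_le hm measurable_const)

/-- **Two thin shells cost `r²` in configuration space.** For two distinct unordered pairs
`{i, j} ≠ {k, l}` of labels, the Haar measure of the centre configurations on `(𝕋³)ⁿ` in which both
pairs are in the shell `ε ≤ dist ≤ ε + r` is at most `(3 r v₁)²` (`0 < ε`, `0 ≤ r`, `ε + r < 1/2`):
the phase-space two-shell estimate `volume_closePair_inter_closePair_le` (GST 2013, Lemma 4.1.2) with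
unit velocity cut-off, whose preimage under `zipConfig` is the product of the configuration event with
the velocity box, divided by the (positive, finite) volume of the velocity box. [folklore] -/
theorem volume_twoShells_le {ε r : ℝ} (hε : 0 < ε) (hr : 0 ≤ r) (h : ε + r < 1 / 2) {n : ℕ}
    {i j k l : Fin n} (hij : i ≠ j) (hkl : k ≠ l) (hne : ({i, j} : Finset (Fin n)) ≠ {k, l}) :
    volume ({x : Fin n → T3 | ε ≤ Torus.euclidDist (x i) (x j) ∧
        Torus.euclidDist (x i) (x j) ≤ ε + r} ∩
      {x | ε ≤ Torus.euclidDist (x k) (x l) ∧ Torus.euclidDist (x k) (x l) ≤ ε + r}) ≤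
      (ENNReal.ofReal (3 * r) * ENNReal.ofReal v₁) ^ 2 := by
  set A : Set (Fin n → T3) := {x : Fin n → T3 | ε ≤ Torus.euclidDist (x i) (x j) ∧
        Torus.euclidDist (x i) (x j) ≤ ε + r} ∩
      {x | ε ≤ Torus.euclidDist (x k) (x l) ∧ Torus.euclidDist (x k) (x l) ≤ ε + r} with hA
  set P : Set (Fin n → V3) := Set.pi univ fun _ => Metric.closedBall (0 : V3) 1 with hP
  have hkey := volume_closePair_inter_closePair_le (d := Fin 3) (N := n) hε hr h hij hkl hne 1
  have hpre : zipConfig ⁻¹' (closePair n (Fin 3) ε r i j ∩ closePair n (Fin 3) ε r k l ∩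
      velBall n (Fin 3) (UnitAddTorus (Fin 3)) 1) = A ×ˢ P := by
    ext ⟨x, v⟩
    simp only [hA, hP, mem_preimage, mem_inter_iff, mem_closePair, velBall, mem_setOf_eq,
      zipConfig_apply, Torus.norm_geometry_sepVec, mem_prod, mem_univ_pi, mem_closedBall_zero_iff]
  have hmeas : MeasurableSet (closePair n (Fin 3) ε r i j ∩ closePair n (Fin 3) ε r k l ∩
      velBall n (Fin 3) (UnitAddTorus (Fin 3)) 1) :=
    ((measurableSet_closePair _ _ _ _).inter (measurableSet_closePair _ _ _ _)).inter
      (measurableSet_velBall _)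
  have hvol : volume (closePair n (Fin 3) ε r i j ∩ closePair n (Fin 3) ε r k l ∩
      velBall n (Fin 3) (UnitAddTorus (Fin 3)) 1) = volume A * volume P := by
    rw [← measurePreserving_zipConfig.measure_preimage hmeas.nullMeasurableSet, hpre,
      Measure.prod_prod]
  have hPvol : volume P = volume (Metric.closedBall (0 : V3) 1) ^ n := by
    rw [hP, volume_pi_pi]
    simp
  have hc0 : volume (Metric.closedBall (0 : V3) 1) ^ n ≠ 0 :=
    pow_ne_zero _ (Metric.measure_closedBall_pos volume _ one_pos).ne'
  have hctop : volume (Metric.closedBall (0 : V3) 1) ^ n ≠ ∞ :=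
    ENNReal.pow_ne_top measure_closedBall_lt_top.ne
  rw [hvol, hPvol] at hkey
  rw [← ENNReal.mul_le_mul_iff_left hc0 hctop]
  refine hkey.trans_eq ?_
  rw [Fintype.card_fin, v₁, ENNReal.ofReal_toReal measure_ball_lt_top.ne]
  push_cast
  ring

/-- **Two prescribed thin shells are quadratically small under the hard-core canonical measure.**
For distinct unordered pairs `{i, j} ≠ {k, l}` and `0 ≤ h` with `ε_N + h < 1/2`, the
`posGibbsMeasure`-probability that both pairs are in the shell `ε_N ≤ dist ≤ ε_N + h` is at most
`144 v₁² h²`: the marginal bound `posGibbsMeasure_marginal_le` for the label set `{i, j, k, l}`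
(factor `2⁴`) and the two-shell volume bound `volume_twoShells_le` (`(3 h v₁)²`). [folklore] -/
theorem posGibbsMeasure_twoShells_le {a σ : ℝ} (ha : 0 < a) (hσ : 0 < σ) (hσ2 : σ < 1 / 2)
    (hlam : v₁ * σ ^ 3 ≤ 1 / 2) (N : ℕ) {h : ℝ} (h0 : 0 ≤ h) (hh : hsDiameter σ N + h < 1 / 2)
    {i j k l : Fin (N + 1)} (hij : i ≠ j) (hkl : k ≠ l)
    (hne : ({i, j} : Finset (Fin (N + 1))) ≠ {k, l}) :
    posGibbsMeasure (fun _ : T3 => a) (hsDiameter σ N) (N + 1)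
      ({x | hsDiameter σ N ≤ Torus.euclidDist (x i) (x j) ∧
          Torus.euclidDist (x i) (x j) ≤ hsDiameter σ N + h} ∩
        {x | hsDiameter σ N ≤ Torus.euclidDist (x k) (x l) ∧
          Torus.euclidDist (x k) (x l) ≤ hsDiameter σ N + h}) ≤
      ENNReal.ofReal (144 * v₁ ^ 2 * h ^ 2) := by
  have hv₁ : 0 < v₁ := v₁_pos
  have hI : ∀ x y : Fin (N + 1) → T3, (∀ m ∈ ({i, j, k, l} : Finset (Fin (N + 1))), x m = y m) →
      (x ∈ ({x | hsDiameter σ N ≤ Torus.euclidDist (x i) (x j) ∧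
          Torus.euclidDist (x i) (x j) ≤ hsDiameter σ N + h} ∩
        {x | hsDiameter σ N ≤ Torus.euclidDist (x k) (x l) ∧
          Torus.euclidDist (x k) (x l) ≤ hsDiameter σ N + h} : Set (Fin (N + 1) → T3)) ↔
       y ∈ ({x | hsDiameter σ N ≤ Torus.euclidDist (x i) (x j) ∧
          Torus.euclidDist (x i) (x j) ≤ hsDiameter σ N + h} ∩
        {x | hsDiameter σ N ≤ Torus.euclidDist (x k) (x l) ∧
          Torus.euclidDist (x k) (x l) ≤ hsDiameter σ N + h} : Set (Fin (N + 1) → T3))) := by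
    intro x y hxy
    have hi : x i = y i := hxy i (by simp)
    have hj : x j = y j := hxy j (by simp)
    have hk : x k = y k := hxy k (by simp)
    have hl : x l = y l := hxy l (by simp)
    simp only [mem_inter_iff, mem_setOf_eq, hi, hj, hk, hl]
  calc posGibbsMeasure (fun _ : T3 => a) (hsDiameter σ N) (N + 1)
        ({x | hsDiameter σ N ≤ Torus.euclidDist (x i) (x j) ∧
            Torus.euclidDist (x i) (x j) ≤ hsDiameter σ N + h} ∩
          {x | hsDiameter σ N ≤ Torus.euclidDist (x k) (x l) ∧
            Torus.euclidDist (x k) (x l) ≤ hsDiameter σ N + h})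
      ≤ 2 ^ ({i, j, k, l} : Finset (Fin (N + 1))).card *
          volume ({x : Fin (N + 1) → T3 | hsDiameter σ N ≤ Torus.euclidDist (x i) (x j) ∧
              Torus.euclidDist (x i) (x j) ≤ hsDiameter σ N + h} ∩
            {x | hsDiameter σ N ≤ Torus.euclidDist (x k) (x l) ∧
              Torus.euclidDist (x k) (x l) ≤ hsDiameter σ N + h}) :=
        posGibbsMeasure_marginal_le ha hσ hσ2 hlam N {i, j, k, l}
          ((measurableSet_shell _ _ i j).inter (measurableSet_shell _ _ k l)) hI
    _ ≤ 2 ^ 4 * (ENNReal.ofReal (3 * h) * ENNReal.ofReal v₁) ^ 2 :=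
        mul_le_mul' (pow_le_pow_right₀ one_le_two Finset.card_le_four)
          (volume_twoShells_le (hsDiameter_pos hσ N) h0 hh hij hkl hne)
    _ = ENNReal.ofReal (144 * v₁ ^ 2 * h ^ 2) := by
        rw [← ENNReal.ofReal_mul (by positivity), ← ENNReal.ofReal_pow (by positivity),
          show (2 : ℝ≥0∞) ^ 4 = ENNReal.ofReal (2 ^ 4) by
            rw [ENNReal.ofReal_pow zero_le_two, ENNReal.ofReal_ofNat],
          ← ENNReal.ofReal_mul (by positivity)]
        congr 1
        ring

/-- **(S2) The two-collision window event is quadratically small.**  Under the homogeneous (rung-0)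
local Gibbs law of `N + 1` hard spheres of diameter `ε_N = hsDiameter σ N` on `𝕋³` (constant profiles
`a, θ > 0`, `u`; `v₁σ³ ≤ 1/2`, `σ < 1/2`), the probability that two DISTINCT unordered pairs are both
within minimal-image distance `ε_N + h` is `O(h²)` as `h → 0` (constants depending on `N, σ`): the law
is supported in the hard-sphere domain, so each such pair sits in a shell of width `h`; the marginal
bound `posGibbsMeasure_marginal_le` and two shell integrations. [folklore] -/
theorem localGibbsLaw_twoClosePairs_le {σ a θ : ℝ} (hσ : 0 < σ) (hσ2 : σ < 1 / 2)
    (hlam : v₁ * σ ^ 3 ≤ 1 / 2) (ha : 0 < a) (hθ : 0 < θ) (u : V3) (N : ℕ)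
    (Φ : HardSphereFlow (Torus.geometry (Fin 3)) (hsDiameter σ N) (N + 1)) :
    ∃ C₂ h₀ : ℝ, 0 < h₀ ∧ ∀ h : ℝ, 0 ≤ h → h ≤ h₀ →
      localGibbsLaw σ (fun _ => a) (fun _ => u) (fun _ => θ) N Φ
        {z | ∃ i j k l : Fin (N + 1), i ≠ j ∧ k ≠ l ∧ ({i, j} : Finset (Fin (N + 1))) ≠ {k, l} ∧
          Torus.euclidDist (z i).1 (z j).1 ≤ hsDiameter σ N + h ∧
          Torus.euclidDist (z k).1 (z l).1 ≤ hsDiameter σ N + h} ≤ ENNReal.ofReal (C₂ * h ^ 2) := by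
  have hε : 0 < hsDiameter σ N := hsDiameter_pos hσ N
  have hε2 : hsDiameter σ N < 1 / 2 := (hsDiameter_le hσ.le N).trans_lt hσ2
  refine ⟨((N + 1 : ℕ) : ℝ) ^ 4 * (144 * v₁ ^ 2), (1 / 2 - hsDiameter σ N) / 2, by linarith,
    fun h h0 hh => ?_⟩
  have hεh : hsDiameter σ N + h < 1 / 2 := by linarith
  -- the union over (possibly non-admissible) label quadruples of the two-shell events
  set A : Fin (N + 1) × Fin (N + 1) × Fin (N + 1) × Fin (N + 1) → Set (Fin (N + 1) → T3) :=
    fun q => {_x | q.1 ≠ q.2.1 ∧ q.2.2.1 ≠ q.2.2.2 ∧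
        ({q.1, q.2.1} : Finset (Fin (N + 1))) ≠ {q.2.2.1, q.2.2.2}} ∩
      ({x | hsDiameter σ N ≤ Torus.euclidDist (x q.1) (x q.2.1) ∧
          Torus.euclidDist (x q.1) (x q.2.1) ≤ hsDiameter σ N + h} ∩
        {x | hsDiameter σ N ≤ Torus.euclidDist (x q.2.2.1) (x q.2.2.2) ∧
          Torus.euclidDist (x q.2.2.1) (x q.2.2.2) ≤ hsDiameter σ N + h}) with hA
  have hAm : ∀ q, MeasurableSet (A q) := fun q =>
    (MeasurableSet.const _).inter
      ((measurableSet_shell _ _ q.1 q.2.1).inter (measurableSet_shell _ _ q.2.2.1 q.2.2.2))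
  have hS'm : MeasurableSet ((⋃ q, A q) ∪ (posDomain (hsDiameter σ N) (N + 1))ᶜ) :=
    (MeasurableSet.iUnion hAm).union (measurableSet_posDomain _ _).compl
  -- on the support, `dist ≤ ε + h` upgrades to the shell condition
  have hsub : {z : Config (N + 1) (Fin 3) T3 | ∃ i j k l : Fin (N + 1), i ≠ j ∧ k ≠ l ∧
        ({i, j} : Finset (Fin (N + 1))) ≠ {k, l} ∧
        Torus.euclidDist (z i).1 (z j).1 ≤ hsDiameter σ N + h ∧
        Torus.euclidDist (z k).1 (z l).1 ≤ hsDiameter σ N + h} ⊆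
      (fun z m => (z m).1) ⁻¹' ((⋃ q, A q) ∪ (posDomain (hsDiameter σ N) (N + 1))ᶜ) := by
    rintro z ⟨i, j, k, l, hij, hkl, hne, h1, h2⟩
    rw [mem_preimage, mem_union, mem_iUnion, mem_compl_iff]
    by_cases hzD : (fun m => (z m).1) ∈ posDomain (hsDiameter σ N) (N + 1)
    · exact Or.inl ⟨(i, j, k, l), ⟨hij, hkl, hne⟩, ⟨hzD i j hij, h1⟩, ⟨hzD k l hkl, h2⟩⟩
    · exact Or.inr hzD
  -- each term of the union bound
  have hterm : ∀ q, posGibbsMeasure (fun _ : T3 => a) (hsDiameter σ N) (N + 1) (A q) ≤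
      ENNReal.ofReal (144 * v₁ ^ 2 * h ^ 2) := by
    rintro ⟨i, j, k, l⟩
    by_cases hq : i ≠ j ∧ k ≠ l ∧ ({i, j} : Finset (Fin (N + 1))) ≠ {k, l}
    · exact (measure_mono inter_subset_right).trans
        (posGibbsMeasure_twoShells_le ha hσ hσ2 hlam N h0 hεh hq.1 hq.2.1 hq.2.2)
    · have hsub0 : A (i, j, k, l) ⊆ ∅ := fun x hx => hq hx.1
      exact (measure_mono_null hsub0 measure_empty).trans_le zero_le
  calc localGibbsLaw σ (fun _ => a) (fun _ => u) (fun _ => θ) N Φ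
        {z | ∃ i j k l : Fin (N + 1), i ≠ j ∧ k ≠ l ∧ ({i, j} : Finset (Fin (N + 1))) ≠ {k, l} ∧
          Torus.euclidDist (z i).1 (z j).1 ≤ hsDiameter σ N + h ∧
          Torus.euclidDist (z k).1 (z l).1 ≤ hsDiameter σ N + h}
      ≤ localGibbsLaw σ (fun _ => a) (fun _ => u) (fun _ => θ) N Φ
          ((fun z m => (z m).1) ⁻¹' ((⋃ q, A q) ∪ (posDomain (hsDiameter σ N) (N + 1))ᶜ)) :=
        measure_mono hsub
    _ = posGibbsMeasure (fun _ : T3 => a) (hsDiameter σ N) (N + 1)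
          ((⋃ q, A q) ∪ (posDomain (hsDiameter σ N) (N + 1))ᶜ) := by
        rw [localGibbsLaw_eq]
        exact localGibbsMeasure_preimage_pos continuous_const continuous_const continuous_const
          (fun _ => ha.le) (fun _ => hθ) σ N hS'm
    _ ≤ posGibbsMeasure (fun _ : T3 => a) (hsDiameter σ N) (N + 1) (⋃ q, A q) +
          posGibbsMeasure (fun _ : T3 => a) (hsDiameter σ N) (N + 1)
            (posDomain (hsDiameter σ N) (N + 1))ᶜ := measure_union_le _ _
    _ = posGibbsMeasure (fun _ : T3 => a) (hsDiameter σ N) (N + 1) (⋃ q, A q) := by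
        rw [posGibbsMeasure_compl_posDomain, add_zero]
    _ ≤ ∑ q, posGibbsMeasure (fun _ : T3 => a) (hsDiameter σ N) (N + 1) (A q) :=
        measure_iUnion_fintype_le _ _
    _ ≤ ∑ _q : Fin (N + 1) × Fin (N + 1) × Fin (N + 1) × Fin (N + 1),
          ENNReal.ofReal (144 * v₁ ^ 2 * h ^ 2) := Finset.sum_le_sum fun q _ => hterm q
    _ = ENNReal.ofReal (((N + 1 : ℕ) : ℝ) ^ 4) * ENNReal.ofReal (144 * v₁ ^ 2 * h ^ 2) := by
        rw [Finset.sum_const, Finset.card_univ, Fintype.card_prod, Fintype.card_prod,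
          Fintype.card_prod, Fintype.card_fin, nsmul_eq_mul,
          ENNReal.ofReal_pow (Nat.cast_nonneg (α := ℝ) (N + 1)) 4, ENNReal.ofReal_natCast]
        push_cast
        ring
    _ = ENNReal.ofReal (((N + 1 : ℕ) : ℝ) ^ 4 * (144 * v₁ ^ 2) * h ^ 2) := by
        rw [← ENNReal.ofReal_mul (by positivity)]
        congr 1
        ring

/-- **Registered helper stub `stub_windowStaticsTwo`** of crux stmt-AtomisticToContinuum-13078
(rung-0 collision-count bound, part 3b: the two-close-pairs event is `O(h²)`;
= `localGibbsLaw_twoClosePairs_le` in signature form). [folklore] -/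
theorem stub_windowStaticsTwo :
    ∀ (σ a θ : ℝ) (u : V3) (N : ℕ) (Φ : HardSphereFlow (Torus.geometry (Fin 3)) (hsDiameter σ N) (N + 1)), 0 < σ → σ < 1 / 2 → v₁ * σ ^ 3 ≤ 1 / 2 → 0 < a → 0 < θ → ∃ C₂ h₀ : ℝ, 0 < h₀ ∧ ∀ h : ℝ, 0 ≤ h → h ≤ h₀ → localGibbsLaw σ (fun _ => a) (fun _ => u) (fun _ => θ) N Φ {z | ∃ i j k l : Fin (N + 1), i ≠ j ∧ k ≠ l ∧ ({i, j} : Finset (Fin (N + 1))) ≠ {k, l} ∧ Torus.euclidDist (z i).1 (z j).1 ≤ hsDiameter σ N + h ∧ Torus.euclidDist (z k).1 (z l).1 ≤ hsDiameter σ N + h} ≤ ENNReal.ofReal (C₂ * h ^ 2) :=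
  fun _σ _a _θ u N Φ hσ hσ2 hlam ha hθ => localGibbsLaw_twoClosePairs_le hσ hσ2 hlam ha hθ u N Φ

end Summit.AtomisticToContinuum.HydrodynamicLimit.Theorems

end
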